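import Literature.MathematicalPhysics.QuantumFieldTheory.Balaban1983to89.B8CubeMemberBoxRows
import Literature.MathematicalPhysics.QuantumFieldTheory.Balaban1983to89.B6Ineq268MultiLevelBox
import Literature.MathematicalPhysics.QuantumFieldTheory.Balaban1983to89.B8Eq191FlatDirichletCoercive

/-!
# `Balaban1983to89.B8CubeMemberBoxTowers` — [Balaban1984PropagatorsII] (2.45) ∕ (2.69): the TOWER DICTIONARY between the cube member's towers `(j, Bʲ(x))`
# (consumer `B8Prop6CubeMemberFlatScalar`) and p21's block set `𝔅 = bset (cubeDomains …)` of the host Neumann box — `blkOf(x + t) = (j, blk_{Lʲ}(x + t))`,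
# the sites of that block are the translated sites of the consumer's tower block, and p21's `Q′` of a translated function is the consumer's block average

statement-level skeleton of published theorems with citation tags; proofs where landed; nothing here is a claim about the
Yang–Mills mass gap

`[Balaban1984PropagatorsII]` ("[B6]", CMP **96** (1984) 223–250) (2.1)–(2.4) p. 224, (2.14)–(2.15) p. 225, (2.45) p. 231, (2.69) p. 235; `[Balaban1985RegularSpaces]` ("B8")
(1.31) p. 81, p. 79 (blocks), p. 91 (the operator `Q′`).

CITATION HEADER (lean-in-tree rule).  Cell `pub-ymgap` (YM Track A, HUMAN RULING D-0062), DAG node N05 = [B8], seat `pub-ymgap-dag-n05-c` (g9; (R1′) programme, file F13 =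
brick (b) of the 𝒢-bound programme `B8Thm32GBoundCubeMember.GBoundCubeMemberPrinted`, design `HOME/pub-ymgap-dag-n05-c/R23-DESIGN.md`).  The deep local inverse of
the tower Gram matrix `QT⁻²Qᵀ` is p21's `B6Prop23MultiLevelBox.prop23_multiLevelBox` on the host box `cubeDomains` (F1), stated on p21's block set `bset D` with p21's
block average `QB D` (`QB_apply`: `(W y)⁻¹·Σ_{blkOf x = y}`), weight `W D y = (L^{j_y})^{d+1}` and kernel `Xk D a` of `Q′G′²Q′*`.  THIS FILE is the dictionary at
the level of TOWERS (F1 `tower_iff_lev_eq` was the site-level half, F2 `blk_add_eq_iff` the label-translation half): for `x ∈ □₁` with consumer tower `(j, Bʲ(x))`,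
the p21 block of `x + t` (`t = shift`) is `(j, blk_{Lʲ}(x + t))`; a box site `y′` lies in that block iff `y′ − t` lies in the consumer's tower block; hence
`(Q′ g(· − t))(blkOf(x + t)) = L^{−(d+1)j}Σ_{z∈□₀, Bʲ(z)=Bʲ(x)} g(z)` — p21's `Q′` IS the consumer's `Q` after translation, with the SAME normalisation.

WHAT THIS FILE PROVES (kernel-checked; theorems only; the data regime of F1: `M_h ≥ 1`, `M_hL ∣ ρ`, `M_hL ∣ M`, `R·M_hL ≤ ρ`, `1 ≤ n ≤ k`).
* §1 `blkOf_shift_val` (`(blkOf D ⟨x + t, _⟩).1 = (j, blk (Lʲ) (x + t))`), `blkOf_eq_shift_iff` (`blkOf D y′ = blkOf D ⟨x + t, _⟩ ↔ Bʲ(y′ − t) = Bʲ(x)`).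
* §2 ★ `QB_translate` — `QB D (fun y => g (y − t)) (blkOf D ⟨x + t, _⟩) = ((L^j)^{d+1})⁻¹ · Σ_{z ∈ S, Bʲ(z) = Bʲ(x)} g z` (a `Finset.sum_nbij'` between the two blocks).

HONEST SCOPE ∕ NOT CLAIMED.  Bookkeeping only (no estimate); the remaining dictionary items — `W D (blkOf(x+t)) = (L^{d+1})^j` (immediate from `W_eq` + §1) and the
identification of `Xk D a` read at translated towers with the consumer-normalised kernel of `Q·P_A²·Qᵀ` (`P_A` = translated `gml`) — and the whole analytic part of
the 𝒢-bound stay OPEN.  Count-neutral; N05 NOT discharged; one finite `T⁴` programme at fixed `ε`, Bałaban as printed; nothing continuum ∕ ℝ⁴ ∕ OS ∕ mass-gap ∕ Clay.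
No `sorry`, no `def`, no `instance`, no `notation`.  Unit `pub-ymgap-dag-n05-c` (g9), 2026-08-27.

RELATED IN THE TREE, NOT DUPLICATED: `B8CubeMemberBoxDomains.{cubeDomains, lev, shift, tower_iff_lev_eq, mem_boxDom_of_mem_cube}` (F1, USED), `B8CubeMemberBoxRows.
{pow_dvd_shift, blk_add_eq_iff, blockMap_eq_blk, row_eq_mlOp_row}` (F2, USED ∕ the row-level dictionary), `B6Geom246MultiLevelBox.{bset, blkOf, blkOf_eq_iff_blk}`,
`B6Ineq268MultiLevelBox.{QB, QB_apply, W_eq, Xk, kerOp_Xk}` (p21, USED ∕ targets), `B8Eq191FlatDirichletCoercive.towerBlock_subset_cube` (g8∕n05-e, USED).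
-/
noncomputable section

namespace Literature.MathematicalPhysics.QuantumFieldTheory.Balaban1983to89.B8CubeMemberBoxTowers

open B6MultiLevelBoxOperator (Domains N0)
open B4Reflection242 (boxDom mem_boxDom blk)
open B6Geom246MultiLevelBox (bset blkOf blkOf_val blkOf_eq_iff_blk)
open B6Ineq268MultiLevelBox (W W_eq QB QB_apply)
open B8Eq131Cubes (cube)
open B8Eq131CubesAdmissible (cubeFam cubeFam_false_of_le)
open B8CubeMemberZd (cubeLamS)
open B8Eq191FlatDirichletDepth (mem_cube_of_tower)
open B8Eq191FlatDirichletCoercive (towerBlock_subset_cube)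
open B8Eq191FlatLettersCubeMember (cubeFam_antitone)
open B8CubeMemberBoxDomains (shift boxP lev cubeDomains cubeDomains_lev tower_iff_lev_eq mem_boxDom_of_mem_cube add_shift_sub_shift)
open B8CubeMemberBoxRows (pow_dvd_shift blk_add_eq_iff blockMap_eq_blk)
open Literature.MathematicalPhysics.QuantumLattice (blockMap)

variable {d : ℕ}

/-! ## §1 The tower of a translated site of `□₁` in p21's block set `𝔅` -/

/-- **THE p21 BLOCK OF A TRANSLATED CUBE-MEMBER SITE**: for `x ∈ □₁` with tower `(j, Bʲ(x))` (`Bʲ(x) ∈ Λs_j`, `j ≤ n`), the block `blkOf` of `x + t` in the host box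
`cubeDomains` is `(j, blk_{Lʲ}(x + t))` — the level is the tower level (F1 `tower_iff_lev_eq`).
[cite: Balaban1984PropagatorsII, (2.1)–(2.4) p.224, (2.45) p.231; Balaban1985RegularSpaces, (1.31) p.81] -/
theorem blkOf_shift_val {ℓ Mh : ℕ} (hℓ : 1 ≤ ℓ) (hMh : 1 ≤ Mh) (a : Fin (d + 1) → ℤ) {M ρ k n R : ℕ} (hn : 1 ≤ n) (hnk : n ≤ k)
    (hρd : Mh * (ℓ + 1) ∣ ρ) (hMd : Mh * (ℓ + 1) ∣ M) (hρ0 : 0 < ρ) (hR : R * (Mh * (ℓ + 1)) ≤ ρ)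
    {x : Fin (d + 1) → ℤ} (hx1 : x ∈ cube (ℓ + 1) a M ρ k 1) {j : ℕ} (hjn : j ≤ n)
    (hxj : blockMap ((ℓ + 1) ^ j) x ∈ cubeLamS (ℓ + 1) a M ρ k n j) :
    (blkOf (cubeDomains hMh a hn hnk hρd hMd hρ0 hR) ⟨x + shift ℓ Mh a ρ k n, mem_boxDom_of_mem_cube hℓ hMh a hn hnk hx1⟩).1
      = (j, blk ((ℓ + 1) ^ j) (x + shift ℓ Mh a ρ k n)) := by
  have hρL : ℓ + 1 ≤ ρ := le_trans (Nat.le_mul_of_pos_left _ hMh) (Nat.le_of_dvd hρ0 hρd)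
  have hlev : lev ℓ Mh a M ρ k n (x + shift ℓ Mh a ρ k n) = j := (tower_iff_lev_eq a M hρL hn hnk hjn hx1 (Mh := Mh)).mp hxj
  rw [blkOf_val]
  change (lev ℓ Mh a M ρ k n (x + shift ℓ Mh a ρ k n), blk ((ℓ + 1) ^ lev ℓ Mh a M ρ k n (x + shift ℓ Mh a ρ k n)) (x + shift ℓ Mh a ρ k n))
    = (j, blk ((ℓ + 1) ^ j) (x + shift ℓ Mh a ρ k n))
  rw [hlev]

/-- **THE SITES OF THAT p21 BLOCK ARE THE TRANSLATED SITES OF THE CONSUMER'S TOWER BLOCK**: for `x ∈ □₁` with tower `(j, Bʲ(x))` and a box site `y′`,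
`blkOf y′ = blkOf (x + t) ⇔ y′ − t ∈ □₀ ∧ Bʲ(y′ − t) = Bʲ(x)` (`Lʲ ∣ t`, F2 `blk_add_eq_iff`; the block lies in `□_j ⊆ □₀`).
[cite: Balaban1984PropagatorsII, (2.1)–(2.4) p.224, (2.45) p.231; Balaban1985RegularSpaces, (1.31) p.81, p.79] -/
theorem blkOf_eq_shift_iff {ℓ Mh : ℕ} (hℓ : 1 ≤ ℓ) (hMh : 1 ≤ Mh) (a : Fin (d + 1) → ℤ) {M ρ k n R : ℕ} (hn : 1 ≤ n) (hnk : n ≤ k)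
    (hρd : Mh * (ℓ + 1) ∣ ρ) (hMd : Mh * (ℓ + 1) ∣ M) (hρ0 : 0 < ρ) (hR : R * (Mh * (ℓ + 1)) ≤ ρ)
    {x : Fin (d + 1) → ℤ} (hx1 : x ∈ cube (ℓ + 1) a M ρ k 1) {j : ℕ} (hjn : j ≤ n)
    (hxj : blockMap ((ℓ + 1) ^ j) x ∈ cubeLamS (ℓ + 1) a M ρ k n j) (y' : ↥(boxDom (N0 ℓ Mh n (boxP ℓ M ρ k n)))) :
    blkOf (cubeDomains hMh a hn hnk hρd hMd hρ0 hR) y'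
        = blkOf (cubeDomains hMh a hn hnk hρd hMd hρ0 hR) ⟨x + shift ℓ Mh a ρ k n, mem_boxDom_of_mem_cube hℓ hMh a hn hnk hx1⟩
      ↔ blockMap ((ℓ + 1) ^ j) (y'.1 - shift ℓ Mh a ρ k n) = blockMap ((ℓ + 1) ^ j) x := by
  have hL : 1 ≤ ℓ + 1 := Nat.succ_pos ℓ
  have hLj : 1 ≤ (ℓ + 1) ^ j := Nat.one_le_pow _ _ hL
  have hdvd : ∀ i, (((ℓ + 1) ^ j : ℕ) : ℤ) ∣ shift ℓ Mh a ρ k n i := fun i => pow_dvd_shift ℓ Mh a ρ hjn hnk i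
  have hval := blkOf_shift_val hℓ hMh a hn hnk hρd hMd hρ0 hR hx1 hjn hxj
  rw [blkOf_eq_iff_blk]
  -- the target block's data
  have h1 : (blkOf (cubeDomains hMh a hn hnk hρd hMd hρ0 hR) ⟨x + shift ℓ Mh a ρ k n, mem_boxDom_of_mem_cube hℓ hMh a hn hnk hx1⟩).1.1 = j := by
    rw [hval]
  have h2 : (blkOf (cubeDomains hMh a hn hnk hρd hMd hρ0 hR) ⟨x + shift ℓ Mh a ρ k n, mem_boxDom_of_mem_cube hℓ hMh a hn hnk hx1⟩).1.2
      = blk ((ℓ + 1) ^ j) (x + shift ℓ Mh a ρ k n) := by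
    rw [hval]
  rw [h1, h2]
  have hy : y'.1 = (y'.1 - shift ℓ Mh a ρ k n) + shift ℓ Mh a ρ k n := (sub_add_cancel _ _).symm
  conv_lhs => rw [hy]
  rw [blk_add_eq_iff hLj hdvd, blockMap_eq_blk, blockMap_eq_blk]

/-! ## §2 p21's block average `Q′` of a translated function is the consumer's block average -/

open Classical in
/-- **`Q′` OF A TRANSLATED FUNCTION = THE CONSUMER'S BLOCK AVERAGE**: for `x ∈ □₁` with tower `(j, Bʲ(x))` and `g` on the lattice,
`(Q′(g(· − t)))(blkOf(x + t)) = L^{−(d+1)j}·Σ_{z ∈ □₀, Bʲ(z) = Bʲ(x)} g(z)` — p21's `QB` on the host box `cubeDomains` read at the cube member.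
[cite: Balaban1984PropagatorsII, (2.14)–(2.15) p.225, (2.69) p.235; Balaban1985RegularSpaces, (1.31) p.81, p.91 (the operator `Q′`)] -/
theorem QB_translate {ℓ Mh : ℕ} (hℓ : 1 ≤ ℓ) (hMh : 1 ≤ Mh) (a : Fin (d + 1) → ℤ) {M ρ k n R : ℕ} (hn : 1 ≤ n) (hnk : n ≤ k)
    (hρd : Mh * (ℓ + 1) ∣ ρ) (hMd : Mh * (ℓ + 1) ∣ M) (hρ0 : 0 < ρ) (hR : R * (Mh * (ℓ + 1)) ≤ ρ)
    (S : Finset (Fin (d + 1) → ℤ)) (hS : ∀ z, z ∈ S ↔ z ∈ cubeFam false (ℓ + 1) a M ρ k 0)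
    {x : Fin (d + 1) → ℤ} (hx1 : x ∈ cube (ℓ + 1) a M ρ k 1) {j : ℕ} (hjn : j ≤ n)
    (hxj : blockMap ((ℓ + 1) ^ j) x ∈ cubeLamS (ℓ + 1) a M ρ k n j) (g : (Fin (d + 1) → ℤ) → ℝ) :
    QB (cubeDomains hMh a hn hnk hρd hMd hρ0 hR) (fun y => g (y.1 - shift ℓ Mh a ρ k n))
        (blkOf (cubeDomains hMh a hn hnk hρd hMd hρ0 hR) ⟨x + shift ℓ Mh a ρ k n, mem_boxDom_of_mem_cube hℓ hMh a hn hnk hx1⟩)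
      = (((((ℓ : ℝ) + 1) ^ j) ^ (d + 1)))⁻¹ * ∑ z ∈ S.filter (fun z => blockMap ((ℓ + 1) ^ j) z = blockMap ((ℓ + 1) ^ j) x), g z := by
  have hL : 1 ≤ ℓ + 1 := Nat.succ_pos ℓ
  have hk : 1 ≤ k := hn.trans hnk
  have hρL : ℓ + 1 ≤ ρ := le_trans (Nat.le_mul_of_pos_left _ hMh) (Nat.le_of_dvd hρ0 hρd)
  set D := cubeDomains hMh a hn hnk hρd hMd hρ0 hR with hD
  set s₀ := blkOf D ⟨x + shift ℓ Mh a ρ k n, mem_boxDom_of_mem_cube hℓ hMh a hn hnk hx1⟩ with hs₀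
  have hval : s₀.1 = (j, blk ((ℓ + 1) ^ j) (x + shift ℓ Mh a ρ k n)) := blkOf_shift_val hℓ hMh a hn hnk hρd hMd hρ0 hR hx1 hjn hxj
  rw [QB_apply, W_eq, show s₀.1.1 = j by rw [hval]]
  congr 1
  -- the bijection `y′ ↦ y′ − t` between the sites of the p21 block and the sites of the consumer's tower block
  have hmemS : ∀ z, blockMap ((ℓ + 1) ^ j) z = blockMap ((ℓ + 1) ^ j) x → z ∈ S := fun z hz =>
    (hS z).mpr (towerBlock_subset_cube hL a M hρL hnk hjn hxj hz)
  have hmem1 : ∀ z, blockMap ((ℓ + 1) ^ j) z = blockMap ((ℓ + 1) ^ j) x → z ∈ cube (ℓ + 1) a M ρ k 1 := by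
    intro z hz
    rcases Nat.eq_zero_or_pos j with hj0 | hjpos
    · subst hj0
      have h0 : ∀ y : Fin (d + 1) → ℤ, blockMap ((ℓ + 1) ^ 0) y = y := fun y => by funext i; simp [blockMap]
      rw [h0, h0] at hz
      rw [hz]; exact hx1
    · have hzj : z ∈ cube (ℓ + 1) a M ρ k j := mem_cube_of_tower hL a M ρ (by rw [hz]; exact hxj)
      have hsub := cubeFam_antitone hL a M hρL k hjpos
      rw [cubeFam_false_of_le _ a M ρ (hjn.trans hnk), cubeFam_false_of_le _ a M ρ hk] at hsub
      exact hsub hzj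
  symm
  refine Finset.sum_nbij' (fun z => if h : z + shift ℓ Mh a ρ k n ∈ boxDom (N0 ℓ Mh n (boxP ℓ M ρ k n)) then ⟨z + shift ℓ Mh a ρ k n, h⟩
      else ⟨x + shift ℓ Mh a ρ k n, mem_boxDom_of_mem_cube hℓ hMh a hn hnk hx1⟩)
    (fun y' => y'.1 - shift ℓ Mh a ρ k n) ?_ ?_ ?_ ?_ ?_
  · -- into the p21 block
    intro z hz
    have hzb := (Finset.mem_filter.mp hz).2
    have hbox : z + shift ℓ Mh a ρ k n ∈ boxDom (N0 ℓ Mh n (boxP ℓ M ρ k n)) := mem_boxDom_of_mem_cube hℓ hMh a hn hnk (hmem1 z hzb)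
    rw [dif_pos hbox, Finset.mem_filter]
    refine ⟨Finset.mem_univ _, ?_⟩
    rw [hs₀, blkOf_eq_shift_iff hℓ hMh a hn hnk hρd hMd hρ0 hR hx1 hjn hxj]
    change blockMap ((ℓ + 1) ^ j) (z + shift ℓ Mh a ρ k n - shift ℓ Mh a ρ k n) = blockMap ((ℓ + 1) ^ j) x
    rw [add_sub_cancel_right]; exact hzb
  · -- onto the consumer block
    intro y' hy'
    have hb := (Finset.mem_filter.mp hy').2
    rw [hs₀, blkOf_eq_shift_iff hℓ hMh a hn hnk hρd hMd hρ0 hR hx1 hjn hxj] at hb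
    exact Finset.mem_filter.mpr ⟨hmemS _ hb, hb⟩
  · -- left inverse
    intro z hz
    have hzb := (Finset.mem_filter.mp hz).2
    have hbox : z + shift ℓ Mh a ρ k n ∈ boxDom (N0 ℓ Mh n (boxP ℓ M ρ k n)) := mem_boxDom_of_mem_cube hℓ hMh a hn hnk (hmem1 z hzb)
    rw [dif_pos hbox]
    exact add_sub_cancel_right _ _
  · -- right inverse
    intro y' hy'
    have hbox : y'.1 - shift ℓ Mh a ρ k n + shift ℓ Mh a ρ k n ∈ boxDom (N0 ℓ Mh n (boxP ℓ M ρ k n)) := by rw [sub_add_cancel]; exact y'.2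
    rw [dif_pos hbox]
    exact Subtype.ext (sub_add_cancel _ _)
  · -- the summands agree
    intro z hz
    have hzb := (Finset.mem_filter.mp hz).2
    have hbox : z + shift ℓ Mh a ρ k n ∈ boxDom (N0 ℓ Mh n (boxP ℓ M ρ k n)) := mem_boxDom_of_mem_cube hℓ hMh a hn hnk (hmem1 z hzb)
    rw [dif_pos hbox]
    change g z = g (z + shift ℓ Mh a ρ k n - shift ℓ Mh a ρ k n)
    rw [add_sub_cancel_right]

end Literature.MathematicalPhysics.QuantumFieldTheory.Balaban1983to89.B8CubeMemberBoxTowers
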